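import Summits.Ventures.HodgeRepro2.T5IsotypicDimensionBoundProduct
import Summits.Ventures.HodgeRepro2.T5KTypeOpenKernel

/-!
# T5AdmissibilityHilbert — (A3) item (a) on the Hilbert model: the irreducible `π₀` has
finite-dimensional `K`-isotypic parts

Cell pub-hodge-repro2, seat p5, Tier 5 (route/T5-N4-p5.md, N4.3 v13 (A3), l. 147 — item (a): «the
K-finite vectors of the irreducible π₀ ⊂ L²([U(W_A)]) form an ADMISSIBLE module in Flath's sense —
every K-isotypic part finite-dimensional, K = K_∞ × K_f^{max}»).  This file composes the kernel
STEPS on one carrier: the Hilbert space `E` («L»), the unitary `ρ : A × B →* (E →L[ℂ] E)`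
(«R(G(𝔸))», `A × B = G_∞ × G(𝔸_f)`), its canonical `A`-isotypic parts, the closed `ρ`-irreducible
`W₀` («π₀»), `κ₁ : K₁ →* A`, `κ₂ : K₂ →* B` («K_∞ ⊂ G_∞», «K_f^{max} ⊂ G(𝔸_f)»), a set `K' ⊆ K₂`
(«K′_f»), the `K'`-invariants `Fx := invariants ρ κ₂ K'` («L^{K′_f}») with a decomposition `S` for
the `A`-action (rows 53 / 65 / 72 / 75 supply it), and a `K`-type `ρτ` («ρ = ρ_∞ ⊗ ρ_f») with a
simple `S₁ ≤ ρτ|_{K₁}` («ρ_∞») and `K'` acting trivially on `ρτ` (row 84):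

* `invariants ρ κ₂ K'`: the `K'`-fixed vectors of `E`, a closed subspace;
* `restrictProd`: `ρ` restricted to `W₀` and pulled back to `K₁ × K₂` («π₀ as a K-module»);
* `fixedEquiv`: the `K'`-fixed vectors of `W₀` (row 83's `fixedSubmodule`) ARE the `ℂ[K₁]`-submodule
  `W₀ ⊓ Fx` of `L_π ⊓ Fx` (row 86's `toKSubmodule`) — the identity on vectors, `ℂ[K₁]`-linear;
* **`finite_isotypicComponent_restrictProd`**: for the `π` with `W₀ ≤ L_π` (row 86's STEP 4) and
  `H_π[S₁]` finite-dimensional (admissibility of `π_∞`, [KV] Thm 0.3 — the one named input), the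
  `ρτ`-isotypic part of `W₀` is finite-dimensional — STEP 5 (row 86) fed to STEP 6 (row 83);
* **`exists_openSubgroup_finite_isotypicComponent_restrictProd`**: the same with `K'` produced by
  row 84 from the topology of `K₂` (compact, totally disconnected; `ρτ (1, k)` norm-preserving and
  strongly continuous), the decomposition being given for every open subgroup.

Imports rows 86 / 84 (and rows 76–83 / 85 through them).  Axioms: propext, Classical.choice,
Quot.sound.  README §8(d): uses an L-value-free non-vanishing device: NO.
-/

namespace Summit.Ventures.HodgeRepro2.T5AdmissibilityHilbert

open scoped InnerProductSpace
open Summit.Ventures.HodgeRepro2.T5CompactDiscreteDecomposition (IrreducibleOn)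
open Summit.Ventures.HodgeRepro2.T5FiniteMultiplicity (IsUnitaryEquiv)
open Summit.Ventures.HodgeRepro2.T5FiniteCopiesModule (toRep)
open Summit.Ventures.HodgeRepro2.T5IsotypicStep4Adelic (isotypicPart)
open Summit.Ventures.HodgeRepro2.T5IsotypicDimensionBound (members sumRep)
open Summit.Ventures.HodgeRepro2.T5IsotypicDimensionBoundInvariants (toKSubmodule inf_stable
  inf_le_iSup_members)
open Summit.Ventures.HodgeRepro2.T5IsotypicDimensionBoundProduct (canonH closure_iSup_canonH
  stable_of_restrict)
open Summit.Ventures.HodgeRepro2.T5IsotypicRestrict (compRep ofComp toComp)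
open Summit.Ventures.HodgeRepro2.T5FlathAdmissibleAssembly (fixedSubmodule mem_fixedSubmodule_iff
  finite_isotypicComponent_of_fixed)
open Summit.Ventures.HodgeRepro2.T5IsotypicComponentBound (finite_isotypicComponent_of_equiv)

variable {E : Type*} [NormedAddCommGroup E] [InnerProductSpace ℂ E] [CompleteSpace E]
variable {A B : Type*} [Group A] [Group B]
variable {K₁ K₂ : Type*} [Group K₁] [Group K₂]

section Invariants

omit [CompleteSpace E] in
/-- The `K'`-fixed vectors of `E` under `k ↦ ρ (1, κ₂ k)` («L^{K′_f}»). -/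
def invariants (ρ : A × B →* (E →L[ℂ] E)) (κ₂ : K₂ →* B) (K' : Set K₂) : Submodule ℂ E where
  carrier := {x | ∀ k ∈ K', ρ (1, κ₂ k) x = x}
  add_mem' {x y} hx hy := by
    intro k hk
    rw [map_add, hx k hk, hy k hk]
  zero_mem' := by
    intro k _
    rw [map_zero]
  smul_mem' c x hx := by
    intro k hk
    rw [map_smul, hx k hk]

omit [CompleteSpace E] in
/-- Membership in `invariants`. -/
theorem mem_invariants (ρ : A × B →* (E →L[ℂ] E)) (κ₂ : K₂ →* B) (K' : Set K₂) (x : E) :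
    x ∈ invariants ρ κ₂ K' ↔ ∀ k ∈ K', ρ (1, κ₂ k) x = x :=
  Iff.rfl

omit [CompleteSpace E] in
/-- The invariants form a closed subspace. -/
theorem isClosed_invariants (ρ : A × B →* (E →L[ℂ] E)) (κ₂ : K₂ →* B) (K' : Set K₂) :
    IsClosed ((invariants ρ κ₂ K' : Submodule ℂ E) : Set E) := by
  have : ((invariants ρ κ₂ K' : Submodule ℂ E) : Set E) =
      ⋂ k ∈ K', {x : E | ρ (1, κ₂ k) x = x} := by
    ext x
    simp only [SetLike.mem_coe, mem_invariants, Set.mem_iInter, Set.mem_setOf_eq]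
  rw [this]
  exact isClosed_biInter fun k _ => isClosed_eq (ρ (1, κ₂ k)).continuous continuous_id

/-- `ρ` restricted to `W₀` (through `ρW₀`) and pulled back to `K₁ × K₂` along `κ₁ × κ₂`:
«π₀ as a representation of K_∞ × K_f^{max}». -/
noncomputable def restrictProd {W₀ : Submodule ℂ E}
    (ρW₀ : A × B →* (W₀ →L[ℂ] W₀)) (κ₁ : K₁ →* A) (κ₂ : K₂ →* B) :
    Representation ℂ (K₁ × K₂) W₀ :=
  toRep (ρW₀.comp (MonoidHom.prodMap κ₁ κ₂))

omit [CompleteSpace E] in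
/-- `restrictProd … (k₁, k₂) w = ρ (κ₁ k₁, κ₂ k₂) w` in `E`. -/
theorem coe_restrictProd_apply {ρ : A × B →* (E →L[ℂ] E)} {W₀ : Submodule ℂ E}
    (ρW₀ : A × B →* (W₀ →L[ℂ] W₀)) (hρW₀ : ∀ g (w : W₀), (ρW₀ g w : E) = ρ g w)
    (κ₁ : K₁ →* A) (κ₂ : K₂ →* B) (k : K₁ × K₂) (w : W₀) :
    (restrictProd ρW₀ κ₁ κ₂ k w : E) = ρ (κ₁ k.1, κ₂ k.2) w := by
  change (ρW₀ (MonoidHom.prodMap κ₁ κ₂ k) w : E) = ρ (κ₁ k.1, κ₂ k.2) w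
  rw [hρW₀]
  rfl

end Invariants

section Equiv

variable {P : Type*} {F : P → Type*} [∀ π, NormedAddCommGroup (F π)]
  [∀ π, InnerProductSpace ℂ (F π)] [∀ π, CompleteSpace (F π)]

omit [CompleteSpace E] in
/-- The identity from `(restrictProd ρW₀ κ₁ κ₂).asModule` to `W₀`. -/
def asW {W₀ : Submodule ℂ E} (ρW₀ : A × B →* (W₀ →L[ℂ] W₀)) (κ₁ : K₁ →* A) (κ₂ : K₂ →* B)
    (x : (restrictProd ρW₀ κ₁ κ₂).asModule) : W₀ :=
  x

omit [CompleteSpace E] in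
/-- The identity from `W₀` to `(restrictProd ρW₀ κ₁ κ₂).asModule`. -/
def ofW {W₀ : Submodule ℂ E} (ρW₀ : A × B →* (W₀ →L[ℂ] W₀)) (κ₁ : K₁ →* A) (κ₂ : K₂ →* B)
    (w : W₀) : (restrictProd ρW₀ κ₁ κ₂).asModule :=
  w

omit [CompleteSpace E] in
/-- `asW ∘ ofW = id`. -/
@[simp] theorem asW_ofW {W₀ : Submodule ℂ E} (ρW₀ : A × B →* (W₀ →L[ℂ] W₀)) (κ₁ : K₁ →* A)
    (κ₂ : K₂ →* B) (w : W₀) : asW ρW₀ κ₁ κ₂ (ofW ρW₀ κ₁ κ₂ w) = w := rfl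

omit [CompleteSpace E] in
/-- `ofW ∘ asW = id`. -/
@[simp] theorem ofW_asW {W₀ : Submodule ℂ E} (ρW₀ : A × B →* (W₀ →L[ℂ] W₀)) (κ₁ : K₁ →* A)
    (κ₂ : K₂ →* B) (x : (restrictProd ρW₀ κ₁ κ₂).asModule) : ofW ρW₀ κ₁ κ₂ (asW ρW₀ κ₁ κ₂ x) = x :=
  rfl

omit [CompleteSpace E] in
/-- `asW` is injective. -/
theorem asW_injective {W₀ : Submodule ℂ E} (ρW₀ : A × B →* (W₀ →L[ℂ] W₀)) (κ₁ : K₁ →* A)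
    (κ₂ : K₂ →* B) : Function.Injective (asW ρW₀ κ₁ κ₂) := fun _ _ h => h

omit [CompleteSpace E] in
/-- `asW (single k c • x) = c • restrictProd … k (asW x)`. -/
theorem asW_single_smul {W₀ : Submodule ℂ E} (ρW₀ : A × B →* (W₀ →L[ℂ] W₀)) (κ₁ : K₁ →* A)
    (κ₂ : K₂ →* B) (k : K₁ × K₂) (c : ℂ) (x : (restrictProd ρW₀ κ₁ κ₂).asModule) :
    asW ρW₀ κ₁ κ₂ (MonoidAlgebra.single k c • x) = c • restrictProd ρW₀ κ₁ κ₂ k (asW ρW₀ κ₁ κ₂ x) := by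
  rw [Representation.single_smul]
  rfl

omit [CompleteSpace E] in
/-- A vector of `W₀` fixed by `K'` (in row 83's sense, for `restrictProd`) is fixed by `ρ (1, κ₂ k)`. -/
theorem mem_invariants_of_mem_fixedSubmodule {ρ : A × B →* (E →L[ℂ] E)} {W₀ : Submodule ℂ E}
    (ρW₀ : A × B →* (W₀ →L[ℂ] W₀)) (hρW₀ : ∀ g (w : W₀), (ρW₀ g w : E) = ρ g w)
    (κ₁ : K₁ →* A) (κ₂ : K₂ →* B) (K' : Set K₂)
    (x : (compRep (MonoidHom.inl K₁ K₂) (restrictProd ρW₀ κ₁ κ₂)).asModule)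
    (hx : x ∈ fixedSubmodule (restrictProd ρW₀ κ₁ κ₂) K') :
    (asW ρW₀ κ₁ κ₂ (ofComp (MonoidHom.inl K₁ K₂) (restrictProd ρW₀ κ₁ κ₂) x) : E) ∈
      invariants ρ κ₂ K' := by
  rw [mem_invariants]
  intro k hk
  have h := (mem_fixedSubmodule_iff (restrictProd ρW₀ κ₁ κ₂) K' x).mp hx k hk
  have h' := congrArg (fun w : W₀ => (w : E)) (congrArg (asW ρW₀ κ₁ κ₂) h)
  change (restrictProd ρW₀ κ₁ κ₂ (1, k) (asW ρW₀ κ₁ κ₂ (ofComp (MonoidHom.inl K₁ K₂)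
    (restrictProd ρW₀ κ₁ κ₂) x)) : E) = _ at h'
  rw [coe_restrictProd_apply ρW₀ hρW₀] at h'
  simpa only [map_one] using h'

omit [CompleteSpace E] in
/-- Conversely, a vector of `W₀` fixed by `ρ (1, κ₂ k)` for `k ∈ K'` is fixed in row 83's sense. -/
theorem mem_fixedSubmodule_of_mem_invariants {ρ : A × B →* (E →L[ℂ] E)} {W₀ : Submodule ℂ E}
    (ρW₀ : A × B →* (W₀ →L[ℂ] W₀)) (hρW₀ : ∀ g (w : W₀), (ρW₀ g w : E) = ρ g w)
    (κ₁ : K₁ →* A) (κ₂ : K₂ →* B) (K' : Set K₂) (w : W₀) (hw : (w : E) ∈ invariants ρ κ₂ K') :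
    toComp (MonoidHom.inl K₁ K₂) (restrictProd ρW₀ κ₁ κ₂) (ofW ρW₀ κ₁ κ₂ w) ∈
      fixedSubmodule (restrictProd ρW₀ κ₁ κ₂) K' := by
  rw [mem_fixedSubmodule_iff]
  intro k hk
  rw [T5IsotypicRestrict.ofComp_toComp]
  apply asW_injective ρW₀ κ₁ κ₂
  change restrictProd ρW₀ κ₁ κ₂ (1, k) w = w
  apply Subtype.ext
  rw [coe_restrictProd_apply ρW₀ hρW₀]
  simp only [map_one]
  exact (mem_invariants ρ κ₂ K' w).mp hw k hk

omit [CompleteSpace E] in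
/-- `asW` is additive. -/
@[simp] theorem asW_add {W₀ : Submodule ℂ E} (ρW₀ : A × B →* (W₀ →L[ℂ] W₀)) (κ₁ : K₁ →* A)
    (κ₂ : K₂ →* B) (x y : (restrictProd ρW₀ κ₁ κ₂).asModule) :
    asW ρW₀ κ₁ κ₂ (x + y) = asW ρW₀ κ₁ κ₂ x + asW ρW₀ κ₁ κ₂ y := rfl

section Maps

variable {ρ : A × B →* (E →L[ℂ] E)} (σ : ∀ π, A →* (F π →L[ℂ] F π))
  {S : Set (Submodule ℂ E)} (hS : ∀ W ∈ S, IrreducibleOn (ρ.comp (MonoidHom.inl A B)) W)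
  (κ₁ : K₁ →* A) (κ₂ : K₂ →* B) (K' : Set K₂) (π : P) {W₀ : Submodule ℂ E}
  (ρW₀ : A × B →* (W₀ →L[ℂ] W₀)) (hρW₀ : ∀ g (w : W₀), (ρW₀ g w : E) = ρ g w)
  (hW : ∀ k, ∀ x ∈ W₀ ⊓ invariants ρ κ₂ K',
    (ρ.comp (MonoidHom.inl A B)) (κ₁ k) x ∈ W₀ ⊓ invariants ρ κ₂ K')
  (hle : W₀ ⊓ invariants ρ κ₂ K' ≤
    ⨆ j : members S (canonH (ρ.comp (MonoidHom.inl A B)) σ) π, (j : Submodule ℂ E))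

/-- The `K'`-fixed vectors of `W₀` (row 83's `fixedSubmodule`) sent into `W₀ ⊓ Fx` inside
`L_π ⊓ Fx` (row 86's `toKSubmodule`): the identity on vectors of `E`. -/
noncomputable def fixedToK (x : fixedSubmodule (restrictProd ρW₀ κ₁ κ₂) K') :
    toKSubmodule κ₁ hS (canonH (ρ.comp (MonoidHom.inl A B)) σ) π (W₀ ⊓ invariants ρ κ₂ K') hW :=
  ⟨(sumRep κ₁ hS (canonH (ρ.comp (MonoidHom.inl A B)) σ) π).asModuleEquiv.symm
    ⟨(asW ρW₀ κ₁ κ₂ (ofComp (MonoidHom.inl K₁ K₂) (restrictProd ρW₀ κ₁ κ₂) x.1) : E),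
      hle ⟨(asW ρW₀ κ₁ κ₂ (ofComp (MonoidHom.inl K₁ K₂) (restrictProd ρW₀ κ₁ κ₂) x.1)).2,
        mem_invariants_of_mem_fixedSubmodule ρW₀ hρW₀ κ₁ κ₂ K' x.1 x.2⟩⟩, by
    show ((sumRep κ₁ hS (canonH (ρ.comp (MonoidHom.inl A B)) σ) π).asModuleEquiv
      ((sumRep κ₁ hS (canonH (ρ.comp (MonoidHom.inl A B)) σ) π).asModuleEquiv.symm _) : E) ∈
        W₀ ⊓ invariants ρ κ₂ K'
    rw [LinearEquiv.apply_symm_apply]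
    exact ⟨(asW ρW₀ κ₁ κ₂ (ofComp (MonoidHom.inl K₁ K₂) (restrictProd ρW₀ κ₁ κ₂) x.1)).2,
      mem_invariants_of_mem_fixedSubmodule ρW₀ hρW₀ κ₁ κ₂ K' x.1 x.2⟩⟩

omit [CompleteSpace E] [∀ π, CompleteSpace (F π)] in
/-- `fixedToK` is the identity on vectors of `E`. -/
theorem coe_fixedToK (x : fixedSubmodule (restrictProd ρW₀ κ₁ κ₂) K') :
    ((sumRep κ₁ hS (canonH (ρ.comp (MonoidHom.inl A B)) σ) π).asModuleEquiv
      (fixedToK σ hS κ₁ κ₂ K' π ρW₀ hρW₀ hW hle x).1 : E) =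
      (asW ρW₀ κ₁ κ₂ (ofComp (MonoidHom.inl K₁ K₂) (restrictProd ρW₀ κ₁ κ₂) x.1) : E) := by
  simp only [fixedToK, LinearEquiv.apply_symm_apply]

/-- The inverse direction: a vector of `W₀ ⊓ Fx` as a `K'`-fixed vector of `W₀`. -/
noncomputable def kToFixed
    (y : toKSubmodule κ₁ hS (canonH (ρ.comp (MonoidHom.inl A B)) σ) π (W₀ ⊓ invariants ρ κ₂ K') hW) :
    fixedSubmodule (restrictProd ρW₀ κ₁ κ₂) K' :=
  ⟨toComp (MonoidHom.inl K₁ K₂) (restrictProd ρW₀ κ₁ κ₂) (ofW ρW₀ κ₁ κ₂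
    ⟨((sumRep κ₁ hS (canonH (ρ.comp (MonoidHom.inl A B)) σ) π).asModuleEquiv y.1 : E), y.2.1⟩),
    mem_fixedSubmodule_of_mem_invariants ρW₀ hρW₀ κ₁ κ₂ K' _ y.2.2⟩

omit [CompleteSpace E] [∀ π, CompleteSpace (F π)] in
/-- `kToFixed` is the identity on vectors of `E`. -/
theorem coe_kToFixed
    (y : toKSubmodule κ₁ hS (canonH (ρ.comp (MonoidHom.inl A B)) σ) π (W₀ ⊓ invariants ρ κ₂ K') hW) :
    (asW ρW₀ κ₁ κ₂ (ofComp (MonoidHom.inl K₁ K₂) (restrictProd ρW₀ κ₁ κ₂)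
      (kToFixed σ hS κ₁ κ₂ K' π ρW₀ hρW₀ hW y).1) : E) =
      ((sumRep κ₁ hS (canonH (ρ.comp (MonoidHom.inl A B)) σ) π).asModuleEquiv y.1 : E) := rfl

/-- **The `K'`-fixed vectors of `W₀` are `W₀ ⊓ Fx` inside `L_π ⊓ Fx`**: row 83's
`fixedSubmodule (restrictProd …) K'` and row 86's `toKSubmodule κ₁ … (W₀ ⊓ Fx)` are the same vectors
of `E`, and the identity is `ℂ[K₁]`-linear. -/
noncomputable def fixedEquiv :
    fixedSubmodule (restrictProd ρW₀ κ₁ κ₂) K' ≃ₗ[MonoidAlgebra ℂ K₁]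
      toKSubmodule κ₁ hS (canonH (ρ.comp (MonoidHom.inl A B)) σ) π
        (W₀ ⊓ invariants ρ κ₂ K') hW where
  toFun := fixedToK σ hS κ₁ κ₂ K' π ρW₀ hρW₀ hW hle
  invFun := kToFixed σ hS κ₁ κ₂ K' π ρW₀ hρW₀ hW
  left_inv x := Subtype.ext rfl
  right_inv y := Subtype.ext rfl
  map_add' x y := Subtype.ext (Subtype.ext rfl)
  map_smul' a x := by
    simp only [RingHom.id_apply]
    have key : ∀ (a : MonoidAlgebra ℂ K₁) (x : fixedSubmodule (restrictProd ρW₀ κ₁ κ₂) K'),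
        ((sumRep κ₁ hS (canonH (ρ.comp (MonoidHom.inl A B)) σ) π).asModuleEquiv
          (fixedToK σ hS κ₁ κ₂ K' π ρW₀ hρW₀ hW hle (a • x)).1 : E) =
        ((sumRep κ₁ hS (canonH (ρ.comp (MonoidHom.inl A B)) σ) π).asModuleEquiv
          (a • (fixedToK σ hS κ₁ κ₂ K' π ρW₀ hρW₀ hW hle x).1) : E) := by
      intro a x
      induction a using MonoidAlgebra.induction_linear with
      | zero =>
        rw [zero_smul, zero_smul, map_zero, Submodule.coe_zero, coe_fixedToK, Submodule.coe_zero,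
          T5IsotypicRestrict.ofComp_zero]
        rfl
      | add a b ha hb =>
        rw [add_smul, add_smul, map_add, Submodule.coe_add, ← ha, ← hb, coe_fixedToK, coe_fixedToK,
          coe_fixedToK, Submodule.coe_add, T5IsotypicRestrict.ofComp_add, asW_add, Submodule.coe_add]
      | single g c =>
        rw [coe_fixedToK, Submodule.coe_smul, T5IsotypicRestrict.ofComp_smul,
          MonoidAlgebra.mapDomainRingHom_apply, MonoidAlgebra.mapDomain_single, asW_single_smul,
          Submodule.coe_smul, coe_restrictProd_apply ρW₀ hρW₀, Representation.single_smul]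
        change _ = ((c • (sumRep κ₁ hS (canonH (ρ.comp (MonoidHom.inl A B)) σ) π) g
          ((sumRep κ₁ hS (canonH (ρ.comp (MonoidHom.inl A B)) σ) π).asModuleEquiv
            (fixedToK σ hS κ₁ κ₂ K' π ρW₀ hρW₀ hW hle x).1) :
              ↥(⨆ j : members S (canonH (ρ.comp (MonoidHom.inl A B)) σ) π, (j : Submodule ℂ E))) : E)
        rw [Submodule.coe_smul, T5IsotypicDimensionBound.coe_sumRep_apply, coe_fixedToK]
        simp only [MonoidHom.inl_apply, MonoidHom.comp_apply, map_one]
    exact Subtype.ext ((sumRep κ₁ hS (canonH (ρ.comp (MonoidHom.inl A B)) σ) π).asModuleEquiv.injective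
      (Subtype.ext (key a x)))

end Maps

end Equiv

section Main

variable {P : Type*} {F : P → Type*} [∀ π, NormedAddCommGroup (F π)]
  [∀ π, InnerProductSpace ℂ (F π)] [∀ π, CompleteSpace (F π)]

/-- **(A3) item (a) on the Hilbert model: the `ρτ`-isotypic part of the irreducible `W₀` is
finite-dimensional.**  Hypotheses: `ρ` unitary for `A × B`, the canonical `A`-isotypic data with
dense span, `W₀` closed `ρ`-irreducible with `W₀ ≤ L_π` (row 86's STEP 4 gives such a `π`), a
decomposition `S` of the `K'`-invariants `Fx` for the `A`-action (rows 53 / 65 / 72 / 75), a `K`-type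
`ρτ` irreducible finite-dimensional with a simple `S₁ ≤ ρτ|_{K₁}` and `K'` acting trivially on it,
and `H_π[S₁]` finite-dimensional (admissibility of `π_∞`, [KV] Thm 0.3). -/
theorem finite_isotypicComponent_restrictProd {ρ : A × B →* (E →L[ℂ] E)}
    (hρ : ∀ g, star (ρ g) = ρ g⁻¹)
    (σ : ∀ π, A →* (F π →L[ℂ] F π)) (hσ : ∀ π a, star (σ π a) = σ π a⁻¹)
    (hσirr : ∀ π, ∀ V : Submodule ℂ (F π), IsClosed (V : Set (F π)) →
      (∀ a, ∀ v ∈ V, σ π a v ∈ V) → V = ⊥ ∨ V = ⊤)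
    (hne : ∀ π π', π ≠ π' → ∀ V : F π ≃ₗᵢ[ℂ] F π', ¬ ∀ a x, V (σ π a x) = σ π' a (V x))
    (hdense : (⨆ π, isotypicPart (ρ.comp (MonoidHom.inl A B)) (σ π)).topologicalClosure = ⊤)
    (κ₁ : K₁ →* A) (κ₂ : K₂ →* B) (K' : Set K₂)
    {S : Set (Submodule ℂ E)} (hS : ∀ W ∈ S, IrreducibleOn (ρ.comp (MonoidHom.inl A B)) W)
    (hSo : S.Pairwise (fun W W' => W ⟂ W'))
    (hSd : (sSup S).topologicalClosure = invariants ρ κ₂ K')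
    (hfin : ∀ W₀ ∈ S, {W ∈ S | IsUnitaryEquiv (ρ.comp (MonoidHom.inl A B)) W₀ W}.Finite)
    (π : P) [Nontrivial (F π)] {W₀ : Submodule ℂ E}
    (ρW₀ : A × B →* (W₀ →L[ℂ] W₀)) (hρW₀ : ∀ g (w : W₀), (ρW₀ g w : E) = ρ g w)
    (hπ : W₀ ≤ isotypicPart (ρ.comp (MonoidHom.inl A B)) (σ π))
    {V : Type*} [AddCommGroup V] [Module ℂ V] (ρτ : Representation ℂ (K₁ × K₂) V)
    [ρτ.IsIrreducible]
    (S₁ : Submodule (MonoidAlgebra ℂ K₁) (compRep (MonoidHom.inl K₁ K₂) ρτ).asModule)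
    [IsSimpleModule (MonoidAlgebra ℂ K₁) S₁] (hK' : ∀ k ∈ K', ρτ (1, k) = LinearMap.id)
    [Module.Finite ℂ (isotypicComponent (MonoidAlgebra ℂ K₁) (toRep ((σ π).comp κ₁)).asModule S₁)] :
    Module.Finite ℂ (isotypicComponent (MonoidAlgebra ℂ (K₁ × K₂))
      (restrictProd ρW₀ κ₁ κ₂).asModule ρτ.asModule) := by
  -- STEP 5 (row 86): the S₁-isotypic part of W₀ ⊓ Fx inside L_π ⊓ Fx is finite-dimensional
  have hW₀s : ∀ g, ∀ x ∈ W₀, ρ g x ∈ W₀ := stable_of_restrict ρW₀ hρW₀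
  obtain ⟨-, hfinite, -⟩ :=
    T5IsotypicDimensionBoundProduct.finite_and_finrank_isotypicComponent_inf_le hρ σ hσ hσirr hne
      hdense hS hSo hSd hfin π ρW₀ hρW₀ hπ κ₁ S₁
  -- transport along the identity `fixedEquiv` to row 83's fixedSubmodule, then STEP 6 (row 83)
  have hπ' : W₀ ≤ (⨆ i, canonH (ρ.comp (MonoidHom.inl A B)) σ π i).topologicalClosure := by
    rw [closure_iSup_canonH]
    exact hπ
  have hle : W₀ ⊓ invariants ρ κ₂ K' ≤
      ⨆ j : members S (canonH (ρ.comp (MonoidHom.inl A B)) σ) π, (j : Submodule ℂ E) :=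
    inf_le_iSup_members (ρA := ρ.comp (MonoidHom.inl A B))
      (T5IsotypicStep4Adelic.star_comp_eq hρ (MonoidHom.inl A B)) σ hσ hσirr hne
      (canonH (ρ.comp (MonoidHom.inl A B)) σ) (fun π W => W.2.1) (fun π W a => W.2.2.1 a)
      (fun π W => Classical.choose W.2.2.2) (fun π W => Classical.choose_spec W.2.2.2)
      (by simp only [closure_iSup_canonH]; exact hdense) hS hSo hSd hfin π hπ'
  haveI : Module.Finite ℂ (isotypicComponent (MonoidAlgebra ℂ K₁)
      (fixedSubmodule (restrictProd ρW₀ κ₁ κ₂) K') S₁) :=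
    finite_isotypicComponent_of_equiv
      (M := toKSubmodule κ₁ hS (canonH (ρ.comp (MonoidHom.inl A B)) σ) π
        (W₀ ⊓ invariants ρ κ₂ K') (inf_stable (MonoidHom.inl A B) κ₁ hS hSd hW₀s))
      (N := fixedSubmodule (restrictProd ρW₀ κ₁ κ₂) K') S₁
      (fixedEquiv σ hS κ₁ κ₂ K' π ρW₀ hρW₀ (inf_stable (MonoidHom.inl A B) κ₁ hS hSd hW₀s) hle).symm
  exact finite_isotypicComponent_of_fixed (restrictProd ρW₀ κ₁ κ₂) ρτ S₁ K' hK'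

/-- **(A3) item (a) with the topological input** (row 84): if a decomposition of `L^{K'}` is given for
EVERY open subgroup `K'` of the compact totally disconnected `K₂` (rows 53 / 65 / 72 / 75 give one for
every compact open `K_f`), then for every `K`-type `ρτ` — irreducible finite-dimensional on an inner
product space, `ρτ (1, k)` norm-preserving and strongly continuous — with a simple `S₁ ≤ ρτ|_{K₁}` and
`H_π[S₁]` finite-dimensional, the `ρτ`-isotypic part of `W₀` is finite-dimensional. -/
theorem exists_openSubgroup_finite_isotypicComponent_restrictProd
    [TopologicalSpace K₂] [IsTopologicalGroup K₂] [CompactSpace K₂] [TotallyDisconnectedSpace K₂]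
    {ρ : A × B →* (E →L[ℂ] E)} (hρ : ∀ g, star (ρ g) = ρ g⁻¹)
    (σ : ∀ π, A →* (F π →L[ℂ] F π)) (hσ : ∀ π a, star (σ π a) = σ π a⁻¹)
    (hσirr : ∀ π, ∀ V : Submodule ℂ (F π), IsClosed (V : Set (F π)) →
      (∀ a, ∀ v ∈ V, σ π a v ∈ V) → V = ⊥ ∨ V = ⊤)
    (hne : ∀ π π', π ≠ π' → ∀ V : F π ≃ₗᵢ[ℂ] F π', ¬ ∀ a x, V (σ π a x) = σ π' a (V x))
    (hdense : (⨆ π, isotypicPart (ρ.comp (MonoidHom.inl A B)) (σ π)).topologicalClosure = ⊤)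
    (κ₁ : K₁ →* A) (κ₂ : K₂ →* B)
    (hdec : ∀ K' : OpenSubgroup K₂, ∃ S : Set (Submodule ℂ E),
      (∀ W ∈ S, IrreducibleOn (ρ.comp (MonoidHom.inl A B)) W) ∧
      S.Pairwise (fun W W' => W ⟂ W') ∧
      (sSup S).topologicalClosure = invariants ρ κ₂ (K' : Set K₂) ∧
      ∀ W₀ ∈ S, {W ∈ S | IsUnitaryEquiv (ρ.comp (MonoidHom.inl A B)) W₀ W}.Finite)
    (π : P) [Nontrivial (F π)] {W₀ : Submodule ℂ E}
    (ρW₀ : A × B →* (W₀ →L[ℂ] W₀)) (hρW₀ : ∀ g (w : W₀), (ρW₀ g w : E) = ρ g w)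
    (hπ : W₀ ≤ isotypicPart (ρ.comp (MonoidHom.inl A B)) (σ π))
    {V : Type*} [NormedAddCommGroup V] [InnerProductSpace ℂ V] [FiniteDimensional ℂ V]
    (ρτ : Representation ℂ (K₁ × K₂) V) [ρτ.IsIrreducible]
    (S₁ : Submodule (MonoidAlgebra ℂ K₁) (compRep (MonoidHom.inl K₁ K₂) ρτ).asModule)
    [IsSimpleModule (MonoidAlgebra ℂ K₁) S₁]
    (hnorm : ∀ (k : K₂) (v : V), ‖ρτ (1, k) v‖ = ‖v‖)
    (hcont : ∀ v : V, Continuous fun k : K₂ => ρτ (1, k) v)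
    [Module.Finite ℂ (isotypicComponent (MonoidAlgebra ℂ K₁) (toRep ((σ π).comp κ₁)).asModule S₁)] :
    Module.Finite ℂ (isotypicComponent (MonoidAlgebra ℂ (K₁ × K₂))
      (restrictProd ρW₀ κ₁ κ₂).asModule ρτ.asModule) := by
  obtain ⟨K', hK'⟩ := T5KTypeOpenKernel.exists_openSubgroup_inr_eq_id ρτ hnorm hcont
  obtain ⟨S, hS, hSo, hSd, hfin⟩ := hdec K'
  exact finite_isotypicComponent_restrictProd hρ σ hσ hσirr hne hdense κ₁ κ₂ (K' : Set K₂) hS hSo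
    hSd hfin π ρW₀ hρW₀ hπ ρτ S₁ (fun k hk => hK' k hk)

end Main

end Summit.Ventures.HodgeRepro2.T5AdmissibilityHilbert
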